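/-
Origin: expansion seat `planner-pub-hodgecm-pv12-g5-0`, handover #2 2026-08-18T06:52:15Z (`HOME/pub-hodgecm-pv12-g5/lean/Pv12g5/FockExtremalWeight.lean`, md5 91bddd5f, 268 lines);
landed by the gen-7 packager in gate run 25 as `HodgeCM/PerL34/FockExtremalWeight.lean` (import ^import Pv[0-9]+g[0-9]+\.→import HodgeCM.PerL34. ×1).
-/
/-
Origin: HOME/pub-hodgecm-pv12-g5/lean/Pv12g5/FockExtremalWeight.lean — session planner-pub-hodgecm-pv12-g5-0 (unit
pub-hodgecm-pv12-g5, DAG-node prover #12 gen 5, the Fock-model seat), addendum to `FockUniqueness.lean` (same seat,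
HANDOVER #1, run-25 queue).  Intended final place: `HodgeCM/PerL34/FockExtremalWeight.lean`, namespace
`HodgeCM.PerL34.Fock.Uniq`.  Imports ONLY `Pv12g5.FockUniqueness` (↦ `HodgeCM.PerL34.FockUniqueness`, the one WIP
import to rewrite).  KERNEL: no hypotheses beyond the displayed ones, no axiom, no placeholder proof, nothing cited.
-/
import Summits.HodgeConjecture.HodgeCM.PerL34.FockUniqueness_2

set_option autoImplicit false

/-!
# The extremal weight of an irreducible `𝔤𝔩₃(ℂ)`-module is unique; `F_k` is characterised by it

`FockUniqueness.lean` proves that two irreducible Lie modules over `𝔤𝔩(ι, ℂ) = Matrix ι ι ℂ` (`ι = {a, b, c}`)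
with nonzero extremal vectors OF THE SAME WEIGHT are isomorphic, and deduces the external characterisation of the
Fock pieces `F_k = fockPiece k` (and of `Sym^d = symPiece d`).  This addendum supplies the other half of the
standard sentence "`F_k` is THE irreducible lowest weight module of lowest weight `(1, k+1, 0)`" (pv05-g3
`FockLowestWeight`, docstring; LEMMAS §3 D5 / §9 S4; GAPS `### pv05g3-K1`, `### pv12g5-Uniq`):

* `exists_eigenvalue_eq_of_mem_wordSpan` — an `H = E_aa - E_cc`-eigenvector in the module generated by an
  extremal vector `v` of weight `wt` has eigenvalue `wt a - wt c + d` for some `d ∈ ℕ` (the grading of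
  `FockUniqueness.lie_H_word` read through `Module.End.eigenspaces_iSupIndep`);
* **`exists_eq_smul_of_isExtremalVec`, `wt_eq_of_isExtremalVec` — in an IRREDUCIBLE module two nonzero extremal
  vectors (for the same ordered triple `a, b, c`, of a priori different weights) are proportional and have the
  same weight**: the extremal (lowest / highest) weight of an irreducible `𝔤𝔩₃(ℂ)`-module is well defined and its
  weight line is one-dimensional;
* `IsExtremalVec.map` — extremal vectors are transported by morphisms of Lie modules;
* **`nonempty_equiv_fockPiece_zpow_iff k` / `_wpow_iff m` / `nonempty_equiv_symPiece_iff d` — an irreducible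
  `𝔤𝔩₃(ℂ)`-Lie module is isomorphic to `F_k` (resp. `F_{-m}`, `Sym^d`) IF AND ONLY IF it contains a nonzero
  lowest weight vector of weight `(1, k+1, 0)` (resp. `(1, 1, -m)`; a nonzero highest weight vector of weight
  `(d, 0, 0)`)**;
* `lowestWeight_fockPiece_zpow k` / `_wpow m`, `highestWeight_symPiece d` — inside `F_k`, `F_{-m}`, `Sym^d` every
  nonzero lowest (resp. highest) weight vector is a multiple of `z₂^k`, `w^m`, `z₁^d` and has THAT weight: the
  lowest weight of `F_k` is `(1, k+1, 0)` and no other.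

All statements are at the level of Lie-algebra modules (Mathlib's `LieModule.IsIrreducible`, `LieModuleEquiv`);
the (𝔤,K)-module ⇄ unitary-representation passage and the comparison with printed Fock-model formulas remain
DICTIONARY / PRINT exactly as recorded in `FockUniqueness.lean` and GAPS `### pv12g5-Uniq`.
-/

noncomputable section

namespace HodgeCM
namespace PerL34
namespace Fock

attribute [local instance 100] LieRing.ofAssociativeRing

namespace Uniq

/-! ## 1. The eigenvalues of `H` on the generated module; uniqueness of the extremal weight -/

section ExtremalWeight

variable {ι : Type*} [Fintype ι] [DecidableEq ι] {a b c : ι}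
variable {M : Type*} [AddCommGroup M] [Module ℂ M] [LieRingModule (Matrix ι ι ℂ) M]
  [LieModule ℂ (Matrix ι ι ℂ) M]
variable {N : Type*} [AddCommGroup N] [Module ℂ N] [LieRingModule (Matrix ι ι ℂ) N]
  [LieModule ℂ (Matrix ι ι ℂ) N]

omit [LieModule ℂ (Matrix ι ι ℂ) M] [LieModule ℂ (Matrix ι ι ℂ) N] in
/-- extremal vectors are transported by morphisms of Lie modules -/
theorem IsExtremalVec.map {wt : ι → ℂ} {v : M} (hv : IsExtremalVec a b c wt v) (f : M →ₗ⁅ℂ, Matrix ι ι ℂ⁆ N) :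
    IsExtremalVec a b c wt (f v) where
  diag i := by rw [← f.map_lie, hv.diag, map_smul]
  kill_ba := by rw [← f.map_lie, hv.kill_ba, map_zero]
  kill_ca := by rw [← f.map_lie, hv.kill_ca, map_zero]
  kill_cb := by rw [← f.map_lie, hv.kill_cb, map_zero]

omit [LieModule ℂ (Matrix ι ι ℂ) M] in
/-- the `H`-eigenvalue of the extremal vector itself -/
theorem lie_H_self {wt : ι → ℂ} {v : M} (hv : IsExtremalVec a b c wt v) : ⁅H a c, v⁆ = (wt a - wt c) • v := by
  rw [sub_lie, hv.diag, hv.diag, sub_smul]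

/-- the module generated by an extremal vector `v` of weight `wt` is contained in the sum of the `H`-eigenspaces of
eigenvalues `wt a - wt c + d`, `d ∈ ℕ` -/
theorem wordSpan_le_iSup_eigenspace (hab : a ≠ b) (hbc : b ≠ c) (hac : a ≠ c) {wt : ι → ℂ} {v : M}
    (hv : IsExtremalVec a b c wt v) :
    wordSpan a b c v ≤ ⨆ d : ℕ, (LieModule.toEnd ℂ (Matrix ι ι ℂ) M (H a c)).eigenspace (wt a - wt c + (d : ℂ)) := by
  rw [wordSpan, Submodule.span_le]
  rintro w ⟨d, hd⟩
  have hw : w ∈ (LieModule.toEnd ℂ (Matrix ι ι ℂ) M (H a c)).eigenspace (wt a - wt c + (d : ℂ)) := by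
    rw [Module.End.mem_eigenspace_iff, LieModule.toEnd_apply_apply]
    exact lie_H_word hab hbc hac hv hd
  exact le_iSup (fun d : ℕ => (LieModule.toEnd ℂ (Matrix ι ι ℂ) M (H a c)).eigenspace (wt a - wt c + (d : ℂ)))
    d hw

/-- **an `H`-eigenvector of the module generated by the extremal vector `v` of weight `wt` has eigenvalue
`wt a - wt c + d` for some `d ∈ ℕ`** -/
theorem exists_eigenvalue_eq_of_mem_wordSpan (hab : a ≠ b) (hbc : b ≠ c) (hac : a ≠ c) {wt : ι → ℂ} {v : M}
    (hv : IsExtremalVec a b c wt v) {p : M} (hp : p ∈ wordSpan a b c v) {μ : ℂ} (hpH : ⁅H a c, p⁆ = μ • p)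
    (hp0 : p ≠ 0) : ∃ d : ℕ, μ = wt a - wt c + (d : ℂ) := by
  by_contra hne
  set T := LieModule.toEnd ℂ (Matrix ι ι ℂ) M (H a c) with hT
  have h1 : p ∈ T.eigenspace μ := by
    rw [Module.End.mem_eigenspace_iff, LieModule.toEnd_apply_apply]
    exact hpH
  have h2 : p ∈ ⨆ (ν : ℂ) (_ : ν ≠ μ), T.eigenspace ν := by
    refine (le_trans (wordSpan_le_iSup_eigenspace hab hbc hac hv) (iSup_le fun d => ?_)) hp
    exact le_iSup₂ (f := fun ν (_ : ν ≠ μ) => T.eigenspace ν) (wt a - wt c + (d : ℂ))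
      (fun h => (not_exists.mp hne d) h.symm)
  have hdis := (Module.End.eigenspaces_iSupIndep T) μ
  exact hp0 ((Submodule.disjoint_def.mp hdis) p h1 h2)

/-- **Uniqueness of the extremal line.**  In an irreducible module two nonzero extremal vectors (for the same
ordered triple, of a priori different weights) are proportional … -/
theorem exists_eq_smul_of_isExtremalVec [LieModule.IsIrreducible ℂ (Matrix ι ι ℂ) M] (hab : a ≠ b)
    (hbc : b ≠ c) (hac : a ≠ c) (huniv : ∀ i, i = a ∨ i = b ∨ i = c) {wt wt' : ι → ℂ} {x y : M}
    (hx : IsExtremalVec a b c wt x) (hy : IsExtremalVec a b c wt' y) (hx0 : x ≠ 0) (hy0 : y ≠ 0) :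
    ∃ t : ℂ, y = t • x := by
  have hxH := lie_H_self hx
  have hyH := lie_H_self hy
  have hyx : y ∈ wordSpan a b c x := by
    rw [wordSpan_eq_top hab hbc hac huniv hx hx0]; exact Submodule.mem_top
  have hxy : x ∈ wordSpan a b c y := by
    rw [wordSpan_eq_top hab hbc hac huniv hy hy0]; exact Submodule.mem_top
  obtain ⟨d, hd⟩ := exists_eigenvalue_eq_of_mem_wordSpan hab hbc hac hx hyx hyH hy0
  obtain ⟨d', hd'⟩ := exists_eigenvalue_eq_of_mem_wordSpan hab hbc hac hy hxy hxH hx0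
  have hdd : ((d + d' : ℕ) : ℂ) = 0 := by
    rw [Nat.cast_add]
    linear_combination (-1 : ℂ) * hd - hd'
  rw [Nat.cast_eq_zero] at hdd
  have hd0 : d = 0 := by omega
  rw [hd0, Nat.cast_zero, add_zero] at hd
  rw [hd] at hyH
  exact eq_smul_of_mem_wordSpan hab hbc hac hx hyx hyH

/-- … **and have the same weight**: the extremal (lowest / highest) weight of an irreducible module is well
defined. -/
theorem wt_eq_of_isExtremalVec [LieModule.IsIrreducible ℂ (Matrix ι ι ℂ) M] (hab : a ≠ b) (hbc : b ≠ c)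
    (hac : a ≠ c) (huniv : ∀ i, i = a ∨ i = b ∨ i = c) {wt wt' : ι → ℂ} {x y : M}
    (hx : IsExtremalVec a b c wt x) (hy : IsExtremalVec a b c wt' y) (hx0 : x ≠ 0) (hy0 : y ≠ 0) :
    wt' = wt := by
  obtain ⟨t, rfl⟩ := exists_eq_smul_of_isExtremalVec hab hbc hac huniv hx hy hx0 hy0
  funext i
  have h1 : ⁅E i i, t • x⁆ = wt' i • (t • x) := hy.diag i
  rw [lie_smul, hx.diag, smul_comm t (wt i) x] at h1
  have h2 : (wt i - wt' i) • (t • x) = 0 := by rw [sub_smul, h1, sub_self]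
  rcases smul_eq_zero.mp h2 with h | h
  · exact (sub_eq_zero.mp h).symm
  · exact absurd h hy0

/-- the external characterisation as an `iff`, general form: an irreducible module `M` is isomorphic to the
irreducible module `N` with nonzero extremal vector `y` of weight `wt` iff `M` has a nonzero extremal vector of
weight `wt` -/
theorem nonempty_equiv_iff_exists_isExtremalVec [LieModule.IsIrreducible ℂ (Matrix ι ι ℂ) M]
    [LieModule.IsIrreducible ℂ (Matrix ι ι ℂ) N] (hab : a ≠ b) (hbc : b ≠ c) (hac : a ≠ c)
    (huniv : ∀ i, i = a ∨ i = b ∨ i = c) {wt : ι → ℂ} {y : N} (hy : IsExtremalVec a b c wt y) (hy0 : y ≠ 0) :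
    Nonempty (M ≃ₗ⁅ℂ, Matrix ι ι ℂ⁆ N) ↔ ∃ x : M, x ≠ 0 ∧ IsExtremalVec a b c wt x := by
  constructor
  · rintro ⟨e⟩
    refine ⟨e.symm y, ?_, ?_⟩
    · intro h
      apply hy0
      have h0 : (e : M →ₗ⁅ℂ, Matrix ι ι ℂ⁆ N) 0 = 0 := map_zero _
      rw [LieModuleEquiv.coe_toLieModuleHom] at h0
      rw [← e.apply_symm_apply y, h, h0]
    · have h := hy.map (e.symm : N →ₗ⁅ℂ, Matrix ι ι ℂ⁆ M)
      rwa [LieModuleEquiv.coe_toLieModuleHom] at h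
  · rintro ⟨x, hx0, hx⟩
    exact nonempty_equiv_of_isExtremalVec hab hbc hac huniv hx hy hx0 hy0

end ExtremalWeight

/-! ## 2. The Fock pieces: the lowest weight of `F_k` is `(1, k+1, 0)` and characterises `F_k` -/

section FockPieces

open HodgeCM.PerL34.Fock

/-- **the lowest weight of `F_k` (`k ≥ 0`) is `(1, k+1, 0)` and its lowest weight line is `ℂ z₂^k`**: every nonzero
lowest weight vector of `F_k`, of whatever weight, is a multiple of `z₂^k` and has weight `(1, k+1, 0)`. -/
theorem lowestWeight_fockPiece_zpow (k : ℕ) {wt : HarmVar → ℂ} {y : ↥(fockPiece (k : ℤ))}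
    (hy : IsExtremalVec (Sum.inl 0) (Sum.inl 1) (Sum.inr ()) wt y) (hy0 : y ≠ 0) :
    wt = zpowWt k ∧ ∃ t : ℂ, y = t • zpowVec k := by
  haveI := fockPiece_isIrreducible (k : ℤ)
  exact ⟨wt_eq_of_isExtremalVec inl0_ne_inl1 inl1_ne_inr inl0_ne_inr harmVar_cases (isExtremalVec_zpowVec k) hy
      (zpowVec_ne_zero k) hy0,
    exists_eq_smul_of_isExtremalVec inl0_ne_inl1 inl1_ne_inr inl0_ne_inr harmVar_cases (isExtremalVec_zpowVec k)
      hy (zpowVec_ne_zero k) hy0⟩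

/-- the lowest weight of `F_{-m}` (`m ≥ 0`) is `(1, 1, -m)` and its lowest weight line is `ℂ w^m` -/
theorem lowestWeight_fockPiece_wpow (m : ℕ) {wt : HarmVar → ℂ} {y : ↥(fockPiece (-(m : ℤ)))}
    (hy : IsExtremalVec (Sum.inl 0) (Sum.inl 1) (Sum.inr ()) wt y) (hy0 : y ≠ 0) :
    wt = wpowWt m ∧ ∃ t : ℂ, y = t • wpowVec m := by
  haveI := fockPiece_isIrreducible (-(m : ℤ))
  exact ⟨wt_eq_of_isExtremalVec inl0_ne_inl1 inl1_ne_inr inl0_ne_inr harmVar_cases (isExtremalVec_wpowVec m) hy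
      (wpowVec_ne_zero m) hy0,
    exists_eq_smul_of_isExtremalVec inl0_ne_inl1 inl1_ne_inr inl0_ne_inr harmVar_cases (isExtremalVec_wpowVec m)
      hy (wpowVec_ne_zero m) hy0⟩

variable {M : Type*} [AddCommGroup M] [Module ℂ M] [LieRingModule (Matrix HarmVar HarmVar ℂ) M]
  [LieModule ℂ (Matrix HarmVar HarmVar ℂ) M]

/-- **`F_k` (`k ≥ 0`) is characterised among irreducible `𝔤𝔩₃(ℂ)`-Lie modules by its lowest weight**: an
irreducible module is `≃ F_k` iff it has a nonzero lowest weight vector of weight `(1, k+1, 0)`. -/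
theorem nonempty_equiv_fockPiece_zpow_iff [LieModule.IsIrreducible ℂ (Matrix HarmVar HarmVar ℂ) M] (k : ℕ) :
    Nonempty (M ≃ₗ⁅ℂ, Matrix HarmVar HarmVar ℂ⁆ ↥(fockPiece (k : ℤ))) ↔
      ∃ x : M, x ≠ 0 ∧ IsExtremalVec (Sum.inl 0) (Sum.inl 1) (Sum.inr ()) (zpowWt k) x := by
  haveI := fockPiece_isIrreducible (k : ℤ)
  exact nonempty_equiv_iff_exists_isExtremalVec inl0_ne_inl1 inl1_ne_inr inl0_ne_inr harmVar_cases
    (isExtremalVec_zpowVec k) (zpowVec_ne_zero k)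

/-- `F_{-m}` (`m ≥ 0`) is characterised among irreducible `𝔤𝔩₃(ℂ)`-Lie modules by its lowest weight `(1, 1, -m)` -/
theorem nonempty_equiv_fockPiece_wpow_iff [LieModule.IsIrreducible ℂ (Matrix HarmVar HarmVar ℂ) M] (m : ℕ) :
    Nonempty (M ≃ₗ⁅ℂ, Matrix HarmVar HarmVar ℂ⁆ ↥(fockPiece (-(m : ℤ)))) ↔
      ∃ x : M, x ≠ 0 ∧ IsExtremalVec (Sum.inl 0) (Sum.inl 1) (Sum.inr ()) (wpowWt m) x := by
  haveI := fockPiece_isIrreducible (-(m : ℤ))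
  exact nonempty_equiv_iff_exists_isExtremalVec inl0_ne_inl1 inl1_ne_inr inl0_ne_inr harmVar_cases
    (isExtremalVec_wpowVec m) (wpowVec_ne_zero m)

/-- hence an irreducible module with a nonzero lowest weight vector has AT MOST ONE Fock piece it is isomorphic to:
the lowest weight decides `k` (cf. pv05-g3 `fockPiece_hom_eq_zero`) -/
theorem eq_of_nonempty_equiv_fockPiece_zpow [LieModule.IsIrreducible ℂ (Matrix HarmVar HarmVar ℂ) M] {k k' : ℕ}
    (hk : Nonempty (M ≃ₗ⁅ℂ, Matrix HarmVar HarmVar ℂ⁆ ↥(fockPiece (k : ℤ))))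
    (hk' : Nonempty (M ≃ₗ⁅ℂ, Matrix HarmVar HarmVar ℂ⁆ ↥(fockPiece (k' : ℤ)))) : k = k' := by
  obtain ⟨x, hx0, hx⟩ := (nonempty_equiv_fockPiece_zpow_iff k).mp hk
  obtain ⟨x', hx0', hx'⟩ := (nonempty_equiv_fockPiece_zpow_iff k').mp hk'
  exact zpowWt_injective (wt_eq_of_isExtremalVec inl0_ne_inl1 inl1_ne_inr inl0_ne_inr harmVar_cases hx' hx hx0' hx0)

end FockPieces

/-! ## 3. The definite pair: the highest weight of `Sym^d` is `(d, 0, 0)` and characterises it -/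

section SymPieces

open HodgeCM.PerL34.Fock

/-- (Ported verbatim from the HodgeCMPerL package; no docstring in the source.) -/
private theorem two_ne_one : (2 : Fin 3) ≠ 1 := by decide
/-- (Ported verbatim from the HodgeCMPerL package; no docstring in the source.) -/
private theorem one_ne_zero' : (1 : Fin 3) ≠ 0 := by decide
/-- (Ported verbatim from the HodgeCMPerL package; no docstring in the source.) -/
private theorem two_ne_zero' : (2 : Fin 3) ≠ 0 := by decide
/-- (Ported verbatim from the HodgeCMPerL package; no docstring in the source.) -/
private theorem fin3_cases (i : Fin 3) : i = 2 ∨ i = 1 ∨ i = 0 := by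
  fin_cases i
  · exact Or.inr (Or.inr rfl)
  · exact Or.inr (Or.inl rfl)
  · exact Or.inl rfl

/-- the highest weight of `Sym^d ℂ³` is `(d, 0, 0)` and its highest weight line is `ℂ z₁^d` -/
theorem highestWeight_symPiece (d : ℕ) {wt : Fin 3 → ℂ} {y : ↥(symPiece d)}
    (hy : IsExtremalVec (2 : Fin 3) 1 0 wt y) (hy0 : y ≠ 0) :
    wt = symWt d ∧ ∃ t : ℂ, y = t • symVec d := by
  haveI := symPiece_isIrreducible d
  exact ⟨wt_eq_of_isExtremalVec two_ne_one one_ne_zero' two_ne_zero' fin3_cases (isExtremalVec_symVec d) hy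
      (symVec_ne_zero d) hy0,
    exists_eq_smul_of_isExtremalVec two_ne_one one_ne_zero' two_ne_zero' fin3_cases (isExtremalVec_symVec d) hy
      (symVec_ne_zero d) hy0⟩

variable {M : Type*} [AddCommGroup M] [Module ℂ M] [LieRingModule (Matrix (Fin 3) (Fin 3) ℂ) M]
  [LieModule ℂ (Matrix (Fin 3) (Fin 3) ℂ) M]

/-- `Sym^d ℂ³` is characterised among irreducible `𝔤𝔩₃(ℂ)`-Lie modules by its highest weight `(d, 0, 0)` -/
theorem nonempty_equiv_symPiece_iff [LieModule.IsIrreducible ℂ (Matrix (Fin 3) (Fin 3) ℂ) M] (d : ℕ) :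
    Nonempty (M ≃ₗ⁅ℂ, Matrix (Fin 3) (Fin 3) ℂ⁆ ↥(symPiece d)) ↔
      ∃ x : M, x ≠ 0 ∧ IsExtremalVec (2 : Fin 3) 1 0 (symWt d) x := by
  haveI := symPiece_isIrreducible d
  exact nonempty_equiv_iff_exists_isExtremalVec two_ne_one one_ne_zero' two_ne_zero' fin3_cases
    (isExtremalVec_symVec d) (symVec_ne_zero d)

end SymPieces

end Uniq

end Fock

end PerL34

end HodgeCM
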